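import Mathlib
import HarnessLib
import Literature.Probability.Distributions.GaussianLinearCompensation

/-!
# Transfer of Gaussian expectations between index sets: functionals of a sub-vector see only the
# sub-covariance ([Buc16] Lemma 4.1, the abstract step of the small-torus localisation)

Let `X ∼ N(0, S)` on `ℝ^ι` and `Y ∼ N(0, S')` on `ℝ^{ι'}` be centred Gaussian vectors and let
`e : σ → ι`, `e' : σ → ι'` pick out sub-vectors `(X_{e(s)})_s`, `(Y_{e'(s)})_s` with the SAME covariance,
`S(e s, e t) = S'(e' s, e' t)`.  Then the two sub-vectors have the same law `N(0, S|_σ)`, so every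
functional of the sub-vector has the same expectation under both Gaussians:

* `selMatrix_mulVec` — the coordinate-selection matrix `P = (1[i = e s])_{s,i}` acts by `P v = v ∘ e`;
* `selMatrix_mul_mul_transpose_apply` — `(P S Pᵀ)(s,t) = S(e s, e t)`;
* `multivariateGaussian_map_selMatrix` — the law of the sub-vector is `N(0, P S Pᵀ)`;
* **`integral_comp_sel_multivariateGaussian_eq`** —
  `∫ g(x ∘ e) dN(0,S)(x) = ∫ g(y ∘ e') dN(0,S')(y)` for strongly measurable `g : (σ → ℝ) → F`.

This is the measure-theoretic core of [Buc16] Lemma 4.1 (an `X`-local functional of the field on the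
torus `T_N` has the same expectation under the finite-range step measure of `T_N` and under the
re-periodised step measure of a smaller torus `T_{N̄}` containing a copy of the support of the
functional, because the two covariances agree on the support).  Everything is proved; no named fact.

## References
* S. Buchholz, J. Funct. Anal. 275 (2018), Lemma 4.1 [Buchholz2016].
* S. Adams, S. Buchholz, R. Kotecký, S. Müller, arXiv:1910.13564, Lemma 8.4 [AdamsBuchholzKoteckyMuller2019].
-/

noncomputable section

open MeasureTheory ProbabilityTheory Matrix
open scoped ENNReal NNReal Matrix

namespace Literature.Probability.Distributions

variable {ι ι' σ : Type} [Fintype ι] [DecidableEq ι] [Fintype ι'] [DecidableEq ι'] [Fintype σ]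
  [DecidableEq σ]

/-! ## The coordinate-selection matrix -/

omit [Fintype σ] [DecidableEq σ] in
/-- The selection matrix `P = (1[i = e s])_{s,i}` acts by `P v = v ∘ e`. [cite: Buchholz2016, Lemma 4.1 (the restriction map τ)] -/
theorem selMatrix_mulVec (e : σ → ι) (v : ι → ℝ) :
    (Matrix.of fun (s : σ) (i : ι) => if i = e s then (1 : ℝ) else 0) *ᵥ v = fun s => v (e s) := by
  funext s
  simp only [Matrix.mulVec, dotProduct, Matrix.of_apply, ite_mul, one_mul, zero_mul,
    Finset.sum_ite_eq', Finset.mem_univ, if_true]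

omit [Fintype σ] [DecidableEq σ] in
/-- `(P S Pᵀ)(s, t) = S(e s, e t)`: the covariance of the selected sub-vector. [cite: Buchholz2016, Lemma 4.1] -/
theorem selMatrix_mul_mul_transpose_apply (e : σ → ι) (S : Matrix ι ι ℝ) (s t : σ) :
    ((Matrix.of fun (s : σ) (i : ι) => if i = e s then (1 : ℝ) else 0) * S *
        (Matrix.of fun (s : σ) (i : ι) => if i = e s then (1 : ℝ) else 0)ᵀ) s t = S (e s) (e t) := by
  rw [Matrix.mul_assoc, Matrix.mul_apply]
  simp only [Matrix.of_apply, ite_mul, one_mul, zero_mul, Finset.sum_ite_eq', Finset.mem_univ, if_true]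
  rw [Matrix.mul_apply]
  simp only [Matrix.transpose_apply, Matrix.of_apply, mul_ite, mul_one, mul_zero, Finset.sum_ite_eq',
    Finset.mem_univ, if_true]

/-- **The law of a sub-vector of a centred Gaussian vector**: the image of `N(0, S)` under
`x ↦ x ∘ e` is `N(0, P S Pᵀ)` with `P = (1[i = e s])_{s,i}`. [cite: Buchholz2016, Lemma 4.1] -/
theorem multivariateGaussian_map_selMatrix {S : Matrix ι ι ℝ} (hS : S.PosSemidef) (e : σ → ι) :
    (multivariateGaussian (0 : EuclideanSpace ℝ ι) S).map
        (matrixCLM (Matrix.of fun (s : σ) (i : ι) => if i = e s then (1 : ℝ) else 0)) =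
      multivariateGaussian (0 : EuclideanSpace ℝ σ)
        ((Matrix.of fun (s : σ) (i : ι) => if i = e s then (1 : ℝ) else 0) * S *
          (Matrix.of fun (s : σ) (i : ι) => if i = e s then (1 : ℝ) else 0)ᵀ) :=
  multivariateGaussian_map_matrix hS _

/-! ## The transfer of expectations -/

/-- **Functionals of a sub-vector see only the sub-covariance** ([Buc16] Lemma 4.1, abstract form): if
`S ⪰ 0` on `ι`, `S' ⪰ 0` on `ι'` and `S(e s, e t) = S'(e' s, e' t)` for all `s, t ∈ σ`, then for every
strongly measurable `g : (σ → ℝ) → F`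
`∫ g(x ∘ e) dN(0,S)(x) = ∫ g(y ∘ e') dN(0,S')(y)`. [cite: Buchholz2016, Lemma 4.1] -/
theorem integral_comp_sel_multivariateGaussian_eq {S : Matrix ι ι ℝ} (hS : S.PosSemidef)
    {S' : Matrix ι' ι' ℝ} (hS' : S'.PosSemidef) (e : σ → ι) (e' : σ → ι')
    (hcov : ∀ s t, S (e s) (e t) = S' (e' s) (e' t))
    {F : Type*} [NormedAddCommGroup F] [NormedSpace ℝ F]
    {g : (σ → ℝ) → F} (hg : StronglyMeasurable g) :
    ∫ x, g (fun s => (WithLp.ofLp x) (e s)) ∂(multivariateGaussian (0 : EuclideanSpace ℝ ι) S) =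
      ∫ y, g (fun s => (WithLp.ofLp y) (e' s)) ∂(multivariateGaussian (0 : EuclideanSpace ℝ ι') S') := by
  set P : Matrix σ ι ℝ := Matrix.of fun (s : σ) (i : ι) => if i = e s then (1 : ℝ) else 0 with hP
  set P' : Matrix σ ι' ℝ := Matrix.of fun (s : σ) (i : ι') => if i = e' s then (1 : ℝ) else 0 with hP'
  -- the two sub-covariances coincide
  have hSub : P * S * Pᵀ = P' * S' * P'ᵀ := by
    ext s t
    rw [selMatrix_mul_mul_transpose_apply, selMatrix_mul_mul_transpose_apply, hcov]
  -- the functional on `ℝ^σ`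
  set G : EuclideanSpace ℝ σ → F := fun z => g (WithLp.ofLp z) with hG
  have hGm : StronglyMeasurable G := hg.comp_measurable (PiLp.continuous_ofLp 2 _).measurable
  have hcomp : ∀ (T : Matrix σ ι ℝ) (x : EuclideanSpace ℝ ι), G (matrixCLM T x) = g (T *ᵥ WithLp.ofLp x) := by
    intro T x; simp only [hG, ofLp_matrixCLM]
  have hcomp' : ∀ (T : Matrix σ ι' ℝ) (y : EuclideanSpace ℝ ι'), G (matrixCLM T y) = g (T *ᵥ WithLp.ofLp y) := by
    intro T y; simp only [hG, ofLp_matrixCLM]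
  have h1 : ∫ x, g (fun s => (WithLp.ofLp x) (e s)) ∂(multivariateGaussian (0 : EuclideanSpace ℝ ι) S) =
      ∫ z, G z ∂((multivariateGaussian (0 : EuclideanSpace ℝ ι) S).map (matrixCLM P)) := by
    rw [integral_map (matrixCLM P).continuous.aemeasurable hGm.aestronglyMeasurable]
    refine integral_congr_ae (ae_of_all _ fun x => ?_)
    show _ = G (matrixCLM P x)
    rw [hcomp, hP, selMatrix_mulVec]
  have h2 : ∫ y, g (fun s => (WithLp.ofLp y) (e' s)) ∂(multivariateGaussian (0 : EuclideanSpace ℝ ι') S') =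
      ∫ z, G z ∂((multivariateGaussian (0 : EuclideanSpace ℝ ι') S').map (matrixCLM P')) := by
    rw [integral_map (matrixCLM P').continuous.aemeasurable hGm.aestronglyMeasurable]
    refine integral_congr_ae (ae_of_all _ fun y => ?_)
    show _ = G (matrixCLM P' y)
    rw [hcomp', hP', selMatrix_mulVec]
  rw [h1, h2, hP, hP', multivariateGaussian_map_selMatrix hS, multivariateGaussian_map_selMatrix hS']
  rw [← hP, ← hP', hSub]

/-- **Integrability transfers along with the law** (same hypotheses): `g(x ∘ e)` is `N(0,S)`-integrable
iff `g(y ∘ e')` is `N(0,S')`-integrable. [cite: Buchholz2016, Lemma 4.1] -/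
theorem integrable_comp_sel_multivariateGaussian_iff {S : Matrix ι ι ℝ} (hS : S.PosSemidef)
    {S' : Matrix ι' ι' ℝ} (hS' : S'.PosSemidef) (e : σ → ι) (e' : σ → ι')
    (hcov : ∀ s t, S (e s) (e t) = S' (e' s) (e' t))
    {F : Type*} [NormedAddCommGroup F] [NormedSpace ℝ F]
    {g : (σ → ℝ) → F} (hg : StronglyMeasurable g) :
    Integrable (fun x => g (fun s => (WithLp.ofLp x) (e s))) (multivariateGaussian (0 : EuclideanSpace ℝ ι) S) ↔
      Integrable (fun y => g (fun s => (WithLp.ofLp y) (e' s)))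
        (multivariateGaussian (0 : EuclideanSpace ℝ ι') S') := by
  set P : Matrix σ ι ℝ := Matrix.of fun (s : σ) (i : ι) => if i = e s then (1 : ℝ) else 0 with hP
  set P' : Matrix σ ι' ℝ := Matrix.of fun (s : σ) (i : ι') => if i = e' s then (1 : ℝ) else 0 with hP'
  have hSub : P * S * Pᵀ = P' * S' * P'ᵀ := by
    ext s t
    rw [selMatrix_mul_mul_transpose_apply, selMatrix_mul_mul_transpose_apply, hcov]
  set G : EuclideanSpace ℝ σ → F := fun z => g (WithLp.ofLp z) with hG
  have hGm : StronglyMeasurable G := hg.comp_measurable (PiLp.continuous_ofLp 2 _).measurable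
  have hfun : (fun x : EuclideanSpace ℝ ι => g (fun s => (WithLp.ofLp x) (e s))) = G ∘ matrixCLM P := by
    funext x; simp only [Function.comp_apply, hG, ofLp_matrixCLM, hP, selMatrix_mulVec]
  have hfun' : (fun y : EuclideanSpace ℝ ι' => g (fun s => (WithLp.ofLp y) (e' s))) = G ∘ matrixCLM P' := by
    funext y; simp only [Function.comp_apply, hG, ofLp_matrixCLM, hP', selMatrix_mulVec]
  rw [hfun, hfun', ← integrable_map_measure hGm.aestronglyMeasurable (matrixCLM P).continuous.aemeasurable,
    ← integrable_map_measure hGm.aestronglyMeasurable (matrixCLM P').continuous.aemeasurable,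
    hP, hP', multivariateGaussian_map_selMatrix hS, multivariateGaussian_map_selMatrix hS']
  rw [← hP, ← hP', hSub]

end Literature.Probability.Distributions

end
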